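import Summits.ValiantsHypothesis.ValiantsHypothesis.Theorems.KPlusLogSqLawTridiagonalSturmJacobi
import Summits.ValiantsHypothesis.ValiantsHypothesis.Theorems.KPlusLogSqLawTridiagonalRealStaticPotentialRow
import Summits.ValiantsHypothesis.ValiantsHypothesis.Theorems.LacunarySymmetroidMatrixDescartesInertiaCertificate

/-!
# Route «KPlusLogSqLaw», crux `WeakLifting` (stmt-ValiantsHypothesis-19561) — REAL side of the tridiagonal sector:
# the STURM-WORD CERTIFICATE for static symmetric tridiagonal designs — a jump of the Sturm count between two scales certifies that many
# DISTINCT positive determinant zeros in between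

HONEST FRAMING.  Helper (`--supports stmt-ValiantsHypothesis-19561 --as helper`), seat val-sym-lift-p2 (g15), cell `pub-symmetroid`, 2026-08-28;
α register, structure / instrument side.  The Jacobi–Sturm rule of the companion file `…TridiagonalSturmJacobi` (same seat) read through
val-sym-mdr-p2's inertia-window law (`Inertia.negIndex_dist_le_sum_corank`) gives, in the register's own continuant currency
`D_k = pathDet a d b f k`, a ROOT CERTIFICATE that needs NO sign change of the determinant: for scales `0 < u ≤ v` at which no `D_k` (`k ≤ m`) vanishes,
`|V(v) − V(u)| ≤ #{distinct zeros of D_m in (u, v)}`, where `V(x) = #{k < m : D_k(x) D_{k+1}(x) < 0}` is the STURM COUNT (number of sign changes of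
`(D_0(x), …, D_m(x))`).  Summed over a chain of scales it bounds `card posRoots` from below (`le_card_posRoots_of_sturmChain`).  Ingredients typed here:
the evaluation glue `eval_pathDet_eq_ctK` (evaluated continuants are the continuants of the evaluated path matrix), the rank bound `corank_le_one`
(a path matrix with non-zero links has corank `≤ 1`: the sub-diagonal minor is triangular), and the Sturm count as the negative index
(`negIndex_eval_eq_sturmCount`).  An instrument, all sizes, nonzero links (definiteness of the diagonal is NOT needed); nothing here bears on
`WeakLifting` / `TropicalB` (stmt-19771) in their windows, on Conjecture B, on the Door-A registers, on `MatrixDescartes` (stmt-18050) or on VP ≠ VNP.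
READING (seat memo, located): on the register's extremal designs the Sturm count «breathes» between `1` and `2`, so this certificate sees at most one
of their `2m − 3` zeros per gap; its use is the opposite one — clustered or even-multiplicity crossings and inertia bookkeeping (`N⁺`, `N⁻`).
[folklore: Sturm sequences / Jacobi's rule / inertia walk]
-/

set_option linter.dupNamespace false
set_option autoImplicit false

namespace Summit.ValiantsHypothesis.ValiantsHypothesis.Theorems.KPlusLogSqLaw

namespace SturmJacobi

open Matrix Finset Polynomial
open scoped BigOperators
open Summit.ValiantsHypothesis.ValiantsHypothesis.Theorems.ValuativeFlip (ctK ctPath ctPath_apply ctK_zero ctK_one ctK_add_two)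
open Summit.ValiantsHypothesis.ValiantsHypothesis.Theorems.KPlusLogSqLaw.StaticTridiagonalRealPotential
  (pathDet pathDet_zero pathDet_one pathDet_add_two)
open Summit.ValiantsHypothesis.ValiantsHypothesis.Theorems.LacunarySymmetroidMatrixDescartes.Inertia
  (negIndex_dist_le_sum_corank sum_card_filter_gap_le)

variable (a : ℕ → ℝ) (d : ℕ → ℕ) (b : ℕ → ℝ) (f : ℕ → ℕ)

/-! ## 1. Evaluation glue -/

/-- **Evaluated continuants = continuants of the evaluated path matrix**:
`(D_k)(x) = ctK (t ↦ a_t x^{d_t}) (t ↦ −b_t x^{f_t}) (t ↦ b_{t−1} x^{f_{t−1}}) k`. [bookkeeping] -/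
theorem eval_pathDet_eq_ctK (x : ℝ) : ∀ k : ℕ, (pathDet a d b f k).eval x =
    ctK (fun t => a t * x ^ d t) (fun t => -(b t * x ^ f t)) (fun t => (fun s => b s * x ^ f s) (t - 1)) k := by
  intro k
  induction k using Nat.strong_induction_on with
  | _ k ih =>
    rcases k with _ | _ | k
    · rw [pathDet_zero, ctK_zero, eval_one]
    · rw [pathDet_one, ctK_one, eval_mul, eval_C, eval_pow, eval_X]
    · rw [pathDet_add_two, ctK_add_two]
      simp only [eval_sub, eval_mul, eval_pow, eval_C, eval_X, ih (k + 1) (by omega), ih k (by omega), Nat.add_sub_cancel]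
      ring

/-- The determinant of the evaluated path matrix is the evaluated `D_k`. [bookkeeping] -/
theorem det_evalPath (x : ℝ) (k : ℕ) :
    (ctPath (fun t => a t * x ^ d t) (fun t => b t * x ^ f t) (fun t => (fun s => b s * x ^ f s) (t - 1)) k).det =
      (pathDet a d b f k).eval x := by
  rw [det_ctPathSymm, eval_pathDet_eq_ctK]

/-- Entries of the evaluated path matrix are continuous in the scale. [bookkeeping] -/
theorem continuous_evalPath_entry (m : ℕ) (i j : Fin m) :
    Continuous fun x : ℝ =>
      ctPath (fun t => a t * x ^ d t) (fun t => b t * x ^ f t) (fun t => (fun s => b s * x ^ f s) (t - 1)) m i j := by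
  simp only [ctPath_apply]
  split_ifs <;> fun_prop

/-! ## 2. Corank at most one -/

/-- **A path matrix with non-zero links has corank `≤ 1`**: deleting the first row and the last column leaves an upper triangular matrix whose
diagonal is the sequence of links. [folklore] -/
theorem corank_le_one (L M : ℕ → ℝ) (n : ℕ) (hM : ∀ t, t < n → M t ≠ 0) :
    Fintype.card (Fin (n + 1)) - (ctPath L M (fun t => M (t - 1)) (n + 1)).rank ≤ 1 := by
  -- the sub-diagonal minor
  set R : Matrix (Fin n) (Fin n) ℝ := (ctPath L M (fun t => M (t - 1)) (n + 1)).submatrix Fin.succ Fin.castSucc with hR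
  have hRentry : ∀ i j : Fin n, R i j = if (j : ℕ) = (i : ℕ) + 1 then L ((i : ℕ) + 1)
      else if (j : ℕ) = (i : ℕ) + 2 then M ((i : ℕ) + 1) else if (j : ℕ) = i then M i else 0 := by
    intro i j
    rw [hR, Matrix.submatrix_apply, ctPath_apply]
    simp only [Fin.val_succ, Fin.val_castSucc]
    split_ifs <;> first | rfl | (exfalso; omega)
  have hRtri : R.BlockTriangular id := by
    intro i j hij
    have h : (j : ℕ) < (i : ℕ) := Fin.lt_def.mp hij
    rw [hRentry, if_neg (by omega), if_neg (by omega), if_neg (by omega)]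
  have hRdet : R.det = ∏ i : Fin n, M i := by
    rw [Matrix.det_of_upperTriangular hRtri]
    refine Finset.prod_congr rfl fun i _ => ?_
    rw [hRentry, if_neg (by omega), if_neg (by omega), if_pos rfl]
  have hRunit : IsUnit R := by
    rw [Matrix.isUnit_iff_isUnit_det, hRdet]
    exact isUnit_iff_ne_zero.mpr (Finset.prod_ne_zero_iff.mpr fun i _ => hM i i.isLt)
  have hrankR : R.rank = n := by rw [Matrix.rank_of_isUnit R hRunit, Fintype.card_fin]
  have hle : R.rank ≤ (ctPath L M (fun t => M (t - 1)) (n + 1)).rank := Matrix.rank_submatrix_le _ _ _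
  rw [Fintype.card_fin]
  omega

/-! ## 3. The Sturm count is the negative index of the evaluated design -/

/-- **Sturm count = negative index** of the evaluated path matrix, at every scale where no `D_k` (`k ≤ m`) vanishes. [folklore: Jacobi] -/
theorem negIndex_eval_eq_sturmCount (m : ℕ) {x : ℝ} (hx : ∀ k, k ≤ m → (pathDet a d b f k).eval x ≠ 0) :
    Fintype.card {j // (ctPathSymm_isHermitian (fun t => a t * x ^ d t) (fun t => b t * x ^ f t) m).eigenvalues j < 0} =
      (Finset.univ.filter fun k : Fin m => (pathDet a d b f k).eval x * (pathDet a d b f (k + 1)).eval x < 0).card := by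
  rw [negIndex_eq_card_signChanges' (fun t => a t * x ^ d t) (fun t => b t * x ^ f t) m
    (fun k hk => by rw [← eval_pathDet_eq_ctK]; exact hx k hk)]
  congr 1
  refine Finset.filter_congr fun k _ => ?_
  rw [← eval_pathDet_eq_ctK, ← eval_pathDet_eq_ctK]

/-! ## 4. The Sturm-word certificate -/

/-- **THE STURM-WORD CERTIFICATE (one gap).**  Non-zero links, scales `0 < u ≤ v` at which no `D_k` (`k ≤ m`) vanishes.  Then the Sturm counts
`V(x) = #{k < m : D_k(x) D_{k+1}(x) < 0}` satisfy `|V(v) − V(u)| ≤ #{distinct zeros of D_m in (u, v)}`.  (No sign change of `D_m` between `u` and `v`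
is needed: a jump of the Sturm count by two certifies two zeros that a sign table cannot see.) [folklore: Sturm / inertia walk] -/
theorem sturmCount_dist_le_card_roots (m : ℕ) (hb : ∀ t, b t ≠ 0) {u v : ℝ} (hu : 0 < u) (huv : u ≤ v)
    (hU : ∀ k, k ≤ m → (pathDet a d b f k).eval u ≠ 0) (hV : ∀ k, k ≤ m → (pathDet a d b f k).eval v ≠ 0) :
    Nat.dist (Finset.univ.filter fun k : Fin m => (pathDet a d b f k).eval v * (pathDet a d b f (k + 1)).eval v < 0).card
        (Finset.univ.filter fun k : Fin m => (pathDet a d b f k).eval u * (pathDet a d b f (k + 1)).eval u < 0).card ≤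
      (((pathDet a d b f m).roots.toFinset).filter fun t => u < t ∧ t < v).card := by
  classical
  -- the evaluated family
  set F : ℝ → Matrix (Fin m) (Fin m) ℝ := fun x =>
    ctPath (fun t => a t * x ^ d t) (fun t => b t * x ^ f t) (fun t => (fun s => b s * x ^ f s) (t - 1)) m with hF
  have hdetF : ∀ x, (F x).det = (pathDet a d b f m).eval x := fun x => det_evalPath a d b f x m
  have hP0 : pathDet a d b f m ≠ 0 := fun h => hU m le_rfl (by rw [h, eval_zero])
  set T := (pathDet a d b f m).roots.toFinset with hT
  have hTmem : ∀ x ∈ Set.Icc u v, (F x).det = 0 → x ∈ T := by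
    intro x _ hx
    rw [hdetF] at hx
    rw [hT, Multiset.mem_toFinset, Polynomial.mem_roots hP0]
    exact hx
  have h := negIndex_dist_le_sum_corank F (continuous_evalPath_entry a d b f m)
    (fun x => ctPathSymm_isHermitian (fun t => a t * x ^ d t) (fun t => b t * x ^ f t) m) T huv hTmem
    (by rw [hdetF]; exact hU m le_rfl) (by rw [hdetF]; exact hV m le_rfl)
  -- corank ≤ 1 at every scale `t > 0`
  have hcor : ∀ t ∈ T.filter (fun t => u < t ∧ t < v), Fintype.card (Fin m) - (F t).rank ≤ 1 := by
    intro t ht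
    obtain ⟨-, h1, -⟩ := Finset.mem_filter.1 ht
    have htpos : 0 < t := hu.trans h1
    rcases m with _ | n
    · simp
    · exact corank_le_one (fun s => a s * t ^ d s) (fun s => b s * t ^ f s) n
        (fun s _ => mul_ne_zero (hb s) (pow_ne_zero _ htpos.ne'))
  have hsum : ∑ t ∈ T.filter (fun t => u < t ∧ t < v), (Fintype.card (Fin m) - (F t).rank) ≤
      (T.filter fun t => u < t ∧ t < v).card := by
    calc ∑ t ∈ T.filter (fun t => u < t ∧ t < v), (Fintype.card (Fin m) - (F t).rank)
        ≤ ∑ t ∈ T.filter (fun t => u < t ∧ t < v), 1 := Finset.sum_le_sum hcor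
      _ = (T.filter fun t => u < t ∧ t < v).card := by simp
  rw [negIndex_eval_eq_sturmCount a d b f m hV, negIndex_eval_eq_sturmCount a d b f m hU] at h
  unfold Nat.dist
  omega

/-- **Corollary — a lower bound for `card posRoots` from two Sturm words.** [folklore] -/
theorem sturmCount_dist_le_card_posRoots (m : ℕ) (hb : ∀ t, b t ≠ 0) {u v : ℝ} (hu : 0 < u) (huv : u ≤ v)
    (hU : ∀ k, k ≤ m → (pathDet a d b f k).eval u ≠ 0) (hV : ∀ k, k ≤ m → (pathDet a d b f k).eval v ≠ 0) :
    Nat.dist (Finset.univ.filter fun k : Fin m => (pathDet a d b f k).eval v * (pathDet a d b f (k + 1)).eval v < 0).card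
        (Finset.univ.filter fun k : Fin m => (pathDet a d b f k).eval u * (pathDet a d b f (k + 1)).eval u < 0).card ≤
      ((pathDet a d b f m).roots.toFinset.filter fun t : ℝ => 0 < t).card := by
  refine (sturmCount_dist_le_card_roots a d b f m hb hu huv hU hV).trans (Finset.card_le_card ?_)
  intro t ht
  rw [Finset.mem_filter] at ht ⊢
  exact ⟨ht.1, hu.trans ht.2.1⟩

/-- **THE STURM-CHAIN CERTIFICATE.**  Non-zero links and scales `0 < x₀ < x₁ < ⋯ < x_N` at which no `D_k` (`k ≤ m`) vanishes: the total variation of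
the Sturm count along the chain bounds the number of distinct zeros of `D_m` in `(x₀, x_N)`, hence `card posRoots`, from below. [folklore] -/
theorem le_card_posRoots_of_sturmChain (m : ℕ) (hb : ∀ t, b t ≠ 0) {N : ℕ} (x : Fin (N + 1) → ℝ) (hx : StrictMono x)
    (hx0 : 0 < x 0) (hnv : ∀ i, ∀ k, k ≤ m → (pathDet a d b f k).eval (x i) ≠ 0) :
    ∑ i : Fin N, Nat.dist
        (Finset.univ.filter fun k : Fin m =>
          (pathDet a d b f k).eval (x i.succ) * (pathDet a d b f (k + 1)).eval (x i.succ) < 0).card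
        (Finset.univ.filter fun k : Fin m =>
          (pathDet a d b f k).eval (x i.castSucc) * (pathDet a d b f (k + 1)).eval (x i.castSucc) < 0).card ≤
      ((pathDet a d b f m).roots.toFinset.filter fun t : ℝ => 0 < t).card := by
  classical
  set T := (pathDet a d b f m).roots.toFinset with hT
  have hpos : ∀ i, 0 < x i := fun i => lt_of_lt_of_le hx0 (hx.monotone (Fin.zero_le i))
  have hgap : ∀ i : Fin N, Nat.dist
        (Finset.univ.filter fun k : Fin m =>
          (pathDet a d b f k).eval (x i.succ) * (pathDet a d b f (k + 1)).eval (x i.succ) < 0).card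
        (Finset.univ.filter fun k : Fin m =>
          (pathDet a d b f k).eval (x i.castSucc) * (pathDet a d b f (k + 1)).eval (x i.castSucc) < 0).card ≤
      Multiset.card (T.val.filter fun t => x i.castSucc < t ∧ t < x i.succ) := by
    intro i
    have h := sturmCount_dist_le_card_roots a d b f m hb (hpos i.castSucc) (hx (Fin.castSucc_lt_succ)).le
      (hnv i.castSucc) (hnv i.succ)
    rw [← Finset.filter_val, Finset.card_val]
    exact h
  refine (Finset.sum_le_sum fun i _ => hgap i).trans ((sum_card_filter_gap_le T.val x hx).trans ?_)
  rw [← Finset.filter_val, Finset.card_val]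
  refine Finset.card_le_card fun t ht => ?_
  rw [Finset.mem_filter] at ht ⊢
  exact ⟨ht.1, hx0.trans ht.2.1⟩

end SturmJacobi

end Summit.ValiantsHypothesis.ValiantsHypothesis.Theorems.KPlusLogSqLaw
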